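import Summits.QuantumAdvantage.QuantumAdvantage.Theorems.SosSandwichTransferPBEventOSMRepr
import HarnessLib

/-!
# Crux `TransferPB` (stmt-QuantumAdvantage-15238, route SosSandwich), line `birth` — the brick programs are in `FP`; the cap

For the brick programs of `Theorems/SosSandwichTransferPBEventOSMDefs.lean`: every piece is a composite of `FP` bricks
under `∘`, `fanoutFn`, `iteFn` — NO clocked loop — so `del0 pw`, `delF pw G`, `iniF pd`, `kapF ∈ FP` by the closure
lemmas alone (**`del0_mem_FP`**, **`delF_mem_FP`**, **`iniF_mem_FP`**, **`kapF_mem_FP`**, with the memberships of all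
pieces); and the cap (`capTest_apply`, `oneBit_capTest`, **`length_capDel_dArg_le`**: the capped transition grows the
state by at most `G(|x|)` on EVERY argument `⟨x, ⟨st, [b]⟩⟩` — the growth hypothesis of `OSM.isPolyTime_alg` —
and **`capDel_dArg_eq`**: no effect where the bound holds). All proved; no named fact.
Source: S. Arora, B. Barak, Computational Complexity (CUP 2009), §1.3 (closure of polynomial time under composition).
-/

-- D-0017: single-conjunct summit ⇒ the duplicate `QuantumAdvantage.QuantumAdvantage` is mandated.
set_option linter.dupNamespace false

noncomputable section

namespace Summit.QuantumAdvantage.QuantumAdvantage.Cruxes.TransferPB.Birth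

open Finset Literature.Computability.Cryptography Literature.Computability.Complexity
  Literature.Computability.QuantumComplexity Literature.Computability.QuantumComplexity.ClassicalSimulation
open Brick Plumb

namespace SimTreePB

namespace EvOSM

section Mem

/-- `mk8` of `FP` maps is in `FP`. [folklore] -/
theorem mk8_mem_FP {f₀ f₁ f₂ f₃ f₄ f₅ f₆ f₇ : List Bool → List Bool} (h₀ : f₀ ∈ FP) (h₁ : f₁ ∈ FP) (h₂ : f₂ ∈ FP)
    (h₃ : f₃ ∈ FP) (h₄ : f₄ ∈ FP) (h₅ : f₅ ∈ FP) (h₆ : f₆ ∈ FP) (h₇ : f₇ ∈ FP) : mk8 f₀ f₁ f₂ f₃ f₄ f₅ f₆ f₇ ∈ FP :=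
  fanoutFn_mem_FP h₀ (fanoutFn_mem_FP h₁ (fanoutFn_mem_FP h₂ (fanoutFn_mem_FP h₃ (fanoutFn_mem_FP h₄
    (fanoutFn_mem_FP h₅ (fanoutFn_mem_FP h₆ h₇))))))

/-- `dX ∈ FP`. [folklore] -/
theorem dX_mem_FP : dX ∈ FP := fstF_mem_FP
/-- `dSt ∈ FP`. [folklore] -/
theorem dSt_mem_FP : dSt ∈ FP := nthF_mem_FP 1
/-- `dBit ∈ FP`. [folklore] -/
theorem dBit_mem_FP : dBit ∈ FP := sndPow_mem_FP 1
/-- `dF i ∈ FP`. [folklore] -/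
theorem dF_mem_FP (i : ℕ) : dF i ∈ FP := comp_mem_FP (nthF_mem_FP i) (nthF_mem_FP 1)
/-- `dB ∈ FP`. [folklore] -/
theorem dB_mem_FP : dB ∈ FP := comp_mem_FP (sndPow_mem_FP 6) (nthF_mem_FP 1)
/-- `kF i ∈ FP`. [folklore] -/
theorem kF_mem_FP (i : ℕ) : kF i ∈ FP := nthF_mem_FP (i + 1)
/-- `isC f c ∈ FP`. [folklore] -/
theorem isC_mem_FP {f : List Bool → List Bool} (hf : f ∈ FP) (c : List Bool) : isC f c ∈ FP :=
  comp_mem_FP eqPairFn_mem_FP (fanoutFn_mem_FP hf (const_mem_FP c))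
/-- `bitT ∈ FP`. [folklore] -/
theorem bitT_mem_FP : bitT ∈ FP := isC_mem_FP dBit_mem_FP _
/-- `hdA ∈ FP`. [folklore] -/
theorem hdA_mem_FP : hdA ∈ FP := comp_mem_FP fstF_mem_FP (dF_mem_FP 5)
/-- `tlA ∈ FP`. [folklore] -/
theorem tlA_mem_FP : tlA ∈ FP := comp_mem_FP sndF_mem_FP (dF_mem_FP 5)
/-- `wOnes pw ∈ FP`. [folklore] -/
theorem wOnes_mem_FP (pw : Polynomial ℕ) : wOnes pw ∈ FP := comp_mem_FP (polyFn_mem_FP pw) dX_mem_FP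
/-- `finNone ∈ FP`. [folklore] -/
theorem finNone_mem_FP : finNone ∈ FP :=
  mk8_mem_FP (const_mem_FP _) (dF_mem_FP 1) (dF_mem_FP 2) (const_mem_FP _) (const_mem_FP _) (const_mem_FP _)
    (const_mem_FP _) (const_mem_FP _)
/-- `finishB Bf ∈ FP`. [folklore] -/
theorem finishB_mem_FP {Bf : List Bool → List Bool} (hB : Bf ∈ FP) : finishB Bf ∈ FP :=
  iteFn_mem_FP (comp_mem_FP (g := isNilFn) isNilFn_mem_FP hB) finNone_mem_FP
    (mk8_mem_FP (const_mem_FP _) (dF_mem_FP 1) (dF_mem_FP 2) (dF_mem_FP 3) (const_mem_FP _)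
      (comp_mem_FP PRelSigma.tail_mem_FP hB) (const_mem_FP _) (const_mem_FP _))
/-- `memU ∈ FP`. [folklore] -/
theorem memU_mem_FP : memU ∈ FP :=
  comp_mem_FP (anyFn_mem_FP eqPairFn_mem_FP oneBit_eqPairFn) (fanoutFn_mem_FP hdA_mem_FP (dF_mem_FP 2))
/-- `app1 f ∈ FP`. [folklore] -/
theorem app1_mem_FP {f : List Bool → List Bool} (hf : f ∈ FP) : app1 f ∈ FP := append_mem_FP hf (const_mem_FP _)
/-- `newB ∈ FP`. [folklore] -/
theorem newB_mem_FP : newB ∈ FP :=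
  iteFn_mem_FP (andFn_mem_FP bitT_mem_FP (notFn_mem_FP memU_mem_FP))
    (iteFn_mem_FP (comp_mem_FP (g := isNilFn) isNilFn_mem_FP dB_mem_FP) (comp_mem_FP (cons_mem_FP true) hdA_mem_FP)
      (iteFn_mem_FP (comp_mem_FP ltFn_mem_FP (fanoutFn_mem_FP (app1_mem_FP hdA_mem_FP)
        (app1_mem_FP (comp_mem_FP PRelSigma.tail_mem_FP dB_mem_FP))))
        (comp_mem_FP (cons_mem_FP true) hdA_mem_FP) dB_mem_FP))
    dB_mem_FP
/-- `proceedF Lf Rf Nf Bf ∈ FP`. [folklore] -/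
theorem proceedF_mem_FP {Lf Rf Nf Bf : List Bool → List Bool} (hL : Lf ∈ FP) (hR : Rf ∈ FP) (hN : Nf ∈ FP)
    (hB : Bf ∈ FP) : proceedF Lf Rf Nf Bf ∈ FP :=
  iteFn_mem_FP (comp_mem_FP (g := isNilFn) isNilFn_mem_FP hR)
    (iteFn_mem_FP (comp_mem_FP (g := isNilFn) isNilFn_mem_FP hL) (finishB_mem_FP hB)
      (iteFn_mem_FP (comp_mem_FP (g := isNilFn) isNilFn_mem_FP hN) (finishB_mem_FP hB)
        (mk8_mem_FP (const_mem_FP _) (dF_mem_FP 1) (dF_mem_FP 2) (dF_mem_FP 3) (comp_mem_FP PRelSigma.tail_mem_FP hL)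
          hN (const_mem_FP _) hB)))
    (mk8_mem_FP (const_mem_FP _) (dF_mem_FP 1) (dF_mem_FP 2) (dF_mem_FP 3) hL hR hN hB)
/-- `delRoot pw ∈ FP`. [folklore] -/
theorem delRoot_mem_FP (pw : Polynomial ℕ) : delRoot pw ∈ FP :=
  iteFn_mem_FP (comp_mem_FP (g := isNilFn) isNilFn_mem_FP (wOnes_mem_FP pw)) finNone_mem_FP
    (iteFn_mem_FP bitT_mem_FP
      (mk8_mem_FP (const_mem_FP _) (dF_mem_FP 1) (dF_mem_FP 2) (dF_mem_FP 3)
        (comp_mem_FP PRelSigma.tail_mem_FP (wOnes_mem_FP pw)) (const_mem_FP _) (const_mem_FP _) (const_mem_FP _))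
      finNone_mem_FP)
/-- `delSingle ∈ FP`. [folklore] -/
theorem delSingle_mem_FP : delSingle ∈ FP :=
  iteFn_mem_FP (comp_mem_FP (g := isNilFn) isNilFn_mem_FP (dF_mem_FP 5)) dSt_mem_FP
    (iteFn_mem_FP (comp_mem_FP (g := isNilFn) isNilFn_mem_FP (dF_mem_FP 4)) (proceedF_mem_FP (dF_mem_FP 4) tlA_mem_FP (dF_mem_FP 6) newB_mem_FP)
      (mk8_mem_FP (const_mem_FP _) (dF_mem_FP 1) (dF_mem_FP 2) (dF_mem_FP 3) (dF_mem_FP 4) (dF_mem_FP 5) (dF_mem_FP 6)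
        newB_mem_FP))
/-- `appendItem Nf a ∈ FP`. [folklore] -/
theorem appendItem_mem_FP {Nf a : List Bool → List Bool} (hN : Nf ∈ FP) (ha : a ∈ FP) : appendItem Nf a ∈ FP := by
  have h : appendItem Nf a = fun z => Nf z ++ fanoutFn a (fun _ => []) z := by
    funext z; simp [appendItem]
  rw [h]
  exact append_mem_FP hN (fanoutFn_mem_FP ha (const_mem_FP _))
/-- `nChild b₀ ∈ FP`. [folklore] -/
theorem nChild_mem_FP (b₀ : Bool) : nChild b₀ ∈ FP :=
  iteFn_mem_FP bitT_mem_FP (appendItem_mem_FP (dF_mem_FP 6) (append_mem_FP hdA_mem_FP (const_mem_FP _))) (dF_mem_FP 6)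
/-- `delBlock0 ∈ FP`. [folklore] -/
theorem delBlock0_mem_FP : delBlock0 ∈ FP :=
  iteFn_mem_FP (comp_mem_FP (g := isNilFn) isNilFn_mem_FP (dF_mem_FP 5)) dSt_mem_FP
    (mk8_mem_FP (const_mem_FP _) (dF_mem_FP 1) (dF_mem_FP 2) (dF_mem_FP 3) (dF_mem_FP 4) (dF_mem_FP 5)
      (nChild_mem_FP false) dB_mem_FP)
/-- `delBlock1 ∈ FP`. [folklore] -/
theorem delBlock1_mem_FP : delBlock1 ∈ FP :=
  iteFn_mem_FP (comp_mem_FP (g := isNilFn) isNilFn_mem_FP (dF_mem_FP 5)) dSt_mem_FP (proceedF_mem_FP (dF_mem_FP 4) tlA_mem_FP (nChild_mem_FP true) dB_mem_FP)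
/-- `newP ∈ FP`. [folklore] -/
theorem newP_mem_FP : newP ∈ FP := by
  have h : newP = fun z => dF 1 z ++ fanoutFn (fun z => dBit z ++ dF 5 z) (fun _ => []) z := by
    funext z; simp [newP]
  rw [h]
  exact append_mem_FP (dF_mem_FP 1) (fanoutFn_mem_FP (append_mem_FP dBit_mem_FP (dF_mem_FP 5)) (const_mem_FP _))
/-- `newU ∈ FP`. [folklore] -/
theorem newU_mem_FP : newU ∈ FP := appendItem_mem_FP (dF_mem_FP 2) (dF_mem_FP 5)
/-- `delAq ∈ FP`. [folklore] -/
theorem delAq_mem_FP : delAq ∈ FP :=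
  iteFn_mem_FP (comp_mem_FP (g := isNilFn) isNilFn_mem_FP (comp_mem_FP PRelSigma.tail_mem_FP (dF_mem_FP 3)))
    (mk8_mem_FP (const_mem_FP _) newP_mem_FP newU_mem_FP (const_mem_FP _) (const_mem_FP _) (const_mem_FP _)
      (const_mem_FP _) (const_mem_FP _))
    (mk8_mem_FP (const_mem_FP _) newP_mem_FP newU_mem_FP (comp_mem_FP PRelSigma.tail_mem_FP (dF_mem_FP 3))
      (const_mem_FP _) (const_mem_FP _) (const_mem_FP _) (const_mem_FP _))
/-- `newC ∈ FP`. [folklore] -/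
theorem newC_mem_FP : newC ∈ FP :=
  iteFn_mem_FP bitT_mem_FP (comp_mem_FP (cons_mem_FP true) (dF_mem_FP 6)) (dF_mem_FP 6)
/-- `delMeans ∈ FP`. [folklore] -/
theorem delMeans_mem_FP : delMeans ∈ FP :=
  iteFn_mem_FP (comp_mem_FP ltLenF_mem_FP (fanoutFn_mem_FP (const_mem_FP _) (dF_mem_FP 4)))
    (mk8_mem_FP (const_mem_FP _) (dF_mem_FP 1) (dF_mem_FP 2) (dF_mem_FP 3) (const_mem_FP _) (const_mem_FP _)
      (const_mem_FP _) (comp_mem_FP ltLenF_mem_FP (fanoutFn_mem_FP (const_mem_FP _) newC_mem_FP)))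
    (mk8_mem_FP (const_mem_FP _) (dF_mem_FP 1) (dF_mem_FP 2) (dF_mem_FP 3) (comp_mem_FP (cons_mem_FP true) (dF_mem_FP 4))
      (const_mem_FP _) newC_mem_FP (const_mem_FP _))
/-- **`del0 pw ∈ FP`.** [cite: AroraBarak2009, §1.3 (closure of polynomial time under composition)] -/
theorem del0_mem_FP (pw : Polynomial ℕ) : del0 pw ∈ FP :=
  iteFn_mem_FP (isC_mem_FP (dF_mem_FP 0) _) (delRoot_mem_FP pw)
    (iteFn_mem_FP (isC_mem_FP (dF_mem_FP 0) _) delSingle_mem_FP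
      (iteFn_mem_FP (isC_mem_FP (dF_mem_FP 0) _) delBlock0_mem_FP
        (iteFn_mem_FP (isC_mem_FP (dF_mem_FP 0) _) delBlock1_mem_FP
          (iteFn_mem_FP (isC_mem_FP (dF_mem_FP 0) _) delAq_mem_FP
            (iteFn_mem_FP (isC_mem_FP (dF_mem_FP 0) _) delMeans_mem_FP dSt_mem_FP)))))
/-- `capTest G body ∈ FP`. [folklore] -/
theorem capTest_mem_FP (G : Polynomial ℕ) {body : List Bool → List Bool} (hb : body ∈ FP) : capTest G body ∈ FP :=
  comp_mem_FP ltLenF_mem_FP (fanoutFn_mem_FP hb (comp_mem_FP appF_mem_FP (fanoutFn_mem_FP dSt_mem_FP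
    (comp_mem_FP (polyFn_mem_FP _) dX_mem_FP))))
/-- `capDel G body ∈ FP`. [folklore] -/
theorem capDel_mem_FP (G : Polynomial ℕ) {body : List Bool → List Bool} (hb : body ∈ FP) : capDel G body ∈ FP :=
  iteFn_mem_FP (capTest_mem_FP G hb) hb dSt_mem_FP
/-- **`delF pw G ∈ FP`.** [cite: AroraBarak2009, §1.3 (closure of polynomial time under composition)] -/
theorem delF_mem_FP (pw G : Polynomial ℕ) : delF pw G ∈ FP := capDel_mem_FP G (del0_mem_FP pw)
/-- **`iniF pd ∈ FP`.** [folklore] -/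
theorem iniF_mem_FP (pd : Polynomial ℕ) : iniF pd ∈ FP :=
  iteFn_mem_FP (comp_mem_FP (g := isNilFn) isNilFn_mem_FP (polyFn_mem_FP pd))
    (mk8_mem_FP (const_mem_FP _) (const_mem_FP _) (const_mem_FP _) (const_mem_FP _) (const_mem_FP _) (const_mem_FP _)
      (const_mem_FP _) (const_mem_FP _))
    (mk8_mem_FP (const_mem_FP _) (const_mem_FP _) (const_mem_FP _) (polyFn_mem_FP pd) (const_mem_FP _) (const_mem_FP _)
      (const_mem_FP _) (const_mem_FP _))
/-- `qryG v ∈ FP`. [folklore] -/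
theorem qryG_mem_FP {v : List Bool → List Bool} (hv : v ∈ FP) : qryG v ∈ FP :=
  comp_mem_FP (cons_mem_FP false) (comp_mem_FP (cons_mem_FP true) (fanoutFn_mem_FP fstF_mem_FP
    (fanoutFn_mem_FP (kF_mem_FP 1) hv)))
/-- **`kapF ∈ FP`.** [folklore] -/
theorem kapF_mem_FP : kapF ∈ FP :=
  iteFn_mem_FP (isC_mem_FP (kF_mem_FP 0) _) (qryG_mem_FP (const_mem_FP _))
    (iteFn_mem_FP (isC_mem_FP (kF_mem_FP 0) _)
      (iteFn_mem_FP (comp_mem_FP (g := isNilFn) isNilFn_mem_FP (kF_mem_FP 5)) (const_mem_FP _)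
        (qryG_mem_FP (comp_mem_FP (cons_mem_FP false) (comp_mem_FP (cons_mem_FP true)
          (comp_mem_FP fstF_mem_FP (kF_mem_FP 5))))))
      (iteFn_mem_FP (isC_mem_FP (kF_mem_FP 0) _)
        (iteFn_mem_FP (comp_mem_FP (g := isNilFn) isNilFn_mem_FP (kF_mem_FP 5)) (const_mem_FP _)
          (qryG_mem_FP (comp_mem_FP (cons_mem_FP false) (comp_mem_FP (cons_mem_FP false)
            (append_mem_FP (comp_mem_FP fstF_mem_FP (kF_mem_FP 5)) (const_mem_FP _))))))
        (iteFn_mem_FP (isC_mem_FP (kF_mem_FP 0) _)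
          (iteFn_mem_FP (comp_mem_FP (g := isNilFn) isNilFn_mem_FP (kF_mem_FP 5)) (const_mem_FP _)
            (qryG_mem_FP (comp_mem_FP (cons_mem_FP false) (comp_mem_FP (cons_mem_FP false)
              (append_mem_FP (comp_mem_FP fstF_mem_FP (kF_mem_FP 5)) (const_mem_FP _))))))
          (iteFn_mem_FP (isC_mem_FP (kF_mem_FP 0) _)
            (comp_mem_FP (cons_mem_FP false) (comp_mem_FP (cons_mem_FP false) (kF_mem_FP 5)))
            (iteFn_mem_FP (isC_mem_FP (kF_mem_FP 0) _) (qryG_mem_FP (comp_mem_FP (cons_mem_FP true) (kF_mem_FP 4)))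
              (iteFn_mem_FP (isC_mem_FP (kF_mem_FP 0) _) (comp_mem_FP (cons_mem_FP true) (sndPow_mem_FP 7))
                (const_mem_FP _)))))))

end Mem

section Cap

variable (G : Polynomial ℕ) (body : List Bool → List Bool)

/-- Value of the cap's length test. [folklore] -/
theorem capTest_apply (z : List Bool) :
    capTest G body z = [decide ((body z).length < (dSt z).length + (G.eval (dX z).length + 1))] := by
  simp [capTest, ltLenF_boolPair, appF_boolPair, polyFn_apply]

/-- The cap's length test is one-bit. [folklore] -/
theorem oneBit_capTest : OneBit (capTest G body) := fun z => ⟨_, capTest_apply G body z⟩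

/-- **The capped body grows additively on EVERY argument `⟨x, ⟨st, [b]⟩⟩`.** [folklore] -/
theorem length_capDel_dArg_le (x st : List Bool) (b : Bool) :
    (capDel G body (dArg x st b)).length ≤ st.length + G.eval x.length := by
  rw [capDel, iteFn_of_oneBit (oneBit_capTest G body), capTest_apply, dSt_dArg, dX_dArg]
  split_ifs with hlt
  · simp at hlt; omega
  · simp

/-- **The cap has no effect where the bound holds.** [folklore] -/
theorem capDel_dArg_eq {x st : List Bool} {b : Bool} (h : (body (dArg x st b)).length ≤ st.length + G.eval x.length) :
    capDel G body (dArg x st b) = body (dArg x st b) := by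
  rw [capDel, iteFn_of_oneBit (oneBit_capTest G body), capTest_apply, dSt_dArg, dX_dArg, if_pos (by simp; omega)]

end Cap

end EvOSM

end SimTreePB

end Summit.QuantumAdvantage.QuantumAdvantage.Cruxes.TransferPB.Birth

end
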